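import Literature.MathematicalPhysics.QuantumFieldTheory.Balaban1983to89.Beta.WilsonWardJets2

/-!
# The BACKGROUND-gauge Ward identity of the Wilson plaquette jets at order `(W², B¹)` — the `(2,2)`-jet with one pure-gauge
# background leg — ENTRYWISE with commutator-sum certificates; part 1: the gauge parameter at the corners `x₁`, `x₂`

NOT IN PRINT; OUR BOOKKEEPING (cell `pub-balaban`, β sub-cell, D1 formalisation swarm seat `b2b-balaban-beta-d1-formalise-leaf-09`,
gen 3; written on the invitation of an1's `SKELETON-D1-L4.v0.md` §4 «(S₂-row law), Wilson sector … owner: an3 or a D1 seat»; an3 owns the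
plaquette-jet algebra this file reads BY NAME and may re-home or rename it).  HONEST FRAMING (cell contract, verbatim): «discharging
`BetaPertH` makes Bałaban's UV stability UNCONDITIONAL — a real constructive-QFT result; it is NOT the continuum limit and NOT the Clay
problem.»  HONEST DEPENDENCY (verbatim): «continuum YM on T⁴ ⇐ BetaPertH ∧ nine spine estimates (0/9 proved); BetaPertH ⇐ (D1) ∧ (D4) ∧
CAP+tail; G-an2-4 gates asym, D1 and NE2/3/4.»  THIS FILE DISCHARGES NOTHING of the wall: it is [folklore] multilinear algebra in an
arbitrary normed algebra — sixteen ring identities under a tracial functional, each certified by an explicit commutator sum — and it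
instantiates no binder of (D1).  ABSOLUTE RULE (cell, verbatim): «No internally-minted statement may enter as a cited fact. Every
hypothesis is either kernel-proved in this package or a verbatim quotation of a PUBLISHED theorem with page reference. The manuscript(s)
under audit are NOT citable for their own disputed steps — they are the thing under adjudication; programme-internal (2001/route/tribunal)
claims are never citable.»  Accordingly nothing is cited, no `def … : Prop` (no `def` at all), and every statement below is kernel-proved
from an3's `Beta.WilsonWardJets2` / `Beta.WilsonVertex2` / `Beta.WilsonVertex` / `Beta.WilsonWardJets` BY NAME.

## What is proved

Setting and letters of an3's Ward series (read `Beta.WilsonWardJets` / `Beta.WilsonWardEntries2` headers): the chart `U_b = e^{W_b}·e^{B_b}`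
(fluctuation LEFT) of [Balaban1985BackgroundPropagators] (3.1) p. 390 = `Beta.WilsonVertex.plaq`, corners `x₁ → x₂ → x₃ ← x₄ ← x₁`,
bonds `b₁ : x₁ → x₂`, `b₂ : x₂ → x₃`, `b₃ : x₄ → x₃`, `b₄ : x₁ → x₄`, the graded jets `F_{2,2} = τ∘P22`, `F_{2,1} = τ∘P21` (the EXACT
bidegree-`(2,2)` / `(2,1)` Taylor components of `τ(U(∂p))`), `Pol f(h, v) = f(h+v) − f(h) − f(v)`, and the two motions already used by
an1/leaf-05 at one order less: the PURE-GAUGE BACKGROUND `W₀λ_b := λ(b₋) − λ(b₊)` (`W₀λ = (λ₁ − λ₂, λ₂ − λ₃, λ₄ − λ₃, λ₁ − λ₄)`) and the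
ADJOINT MOTION OF THE FLUCTUATION AT THE BASE POINT `(ad_λ h)_b := [λ(b₋), h_b]` (`= ([λ₁,h₁], [λ₂,h₂], [λ₄,h₃], [λ₁,h₄])`).  NEW HERE: the
ROTATED BACKGROUND LETTER `(D₁λ B)_b := ½·[λ(b₋) + λ(b₊), B_b]`.  THE IDENTITY, per plaquette, for EVERY ring `𝔸`, every `𝕜`-linear
TRACIAL `τ`:

  `4·Pol_B F_{2,2}(h ; B, W₀λ) + 4·Pol_W F_{2,1}(h, ad_λ h ; B) + 2·F_{2,1}(h ; [λ(b₋)+λ(b₊), B]) = 0`        (bgW₂)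

(`Pol_B` polarises the background slot, `Pol_W` the fluctuation slot; the third term is `4·F_{2,1}(h ; D₁λ B)`).  (bgW₂) is linear in the
background `B`, linear in the gauge parameter `λ` and quadratic in the fluctuation `h`.  THIS FILE proves the ENTRIES `bgWard22_x{k}_b{m}`
for `k ∈ {1, 2}`, `m ∈ {1, 2, 3, 4}` — `λ = l` at the single corner `x_k`, `B = b` on the single bond `b_m`, and the fluctuation quadruple
`h = (h₁, h₂, h₃, h₄)` ARBITRARY — with the groups that vanish identically for the entry omitted (the `ad`-group needs a bond STARTING at
`x_k`; the rotated-letter group needs `x_k ∈ {b_{m,−}, b_{m,+}}`); the companion `Beta.WilsonBackgroundWard22Upper` proves `k ∈ {3, 4}`.  The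
all-letters form (bgW₂) is the bilinear span of the sixteen entries in `(B, λ)` and is deliberately NOT restated here (its one-shot
certificate — a 943-monomial collected difference in twelve letters — exceeds the normaliser's budget, exactly as an3 records for (E₂);
the entries have collected differences of 0 … 136 monomials, certificates of 0 … 98).

METHOD, uniform (an3's `WilsonWardEntries2` architecture, one order of `W ↔ B` across): the integer closed forms
`WilsonWardJets2.four_smul_trace_P22` / `four_smul_trace_P21`, `WilsonVertex.two_smul_trace_P21` (for the rotated-letter term; its residual
`2 • τ(Z_W·twist)` written as a sum inside `τ` by `two_smul`), `two_smul_twist₂_plaq`, `WilsonVertex2.two_smul_qtwistAux` with the recursion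
of `ctwistAux`, then ONE ring identity `inside = Σ_a [a, P_a]` over the six letters against an explicit certificate (`WilsonWardJets.csum`,
grouped by the left letter; 748 certificate monomials over the sixteen entries), checked by `noncomm_ring`, and `τ` kills the commutators
(`WilsonWardJets.trace_eq_zero_of_eq_csum`).  Statements and certificates were generated by an exact free-algebra engine over `ℚ` archived in
the cell (`HOME/b2b-balaban-beta-d1-formalise-leaf-09/g3/bgward2/`: `ncpoly.py`, `identity.py`, `entries.py`, `bch_check.py`, `gen_lean.py`,
SHA256SUMS) which transcribes an3's DEFINITIONS literally and records: (i) the closed forms agree with the recursions modulo cyclic rotation;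
(ii) the all-letters difference of (bgW₂) is cyclically zero (943 raw monomials through the closed forms, 80 through the recursions) while
dropping or negating the rotated-letter term leaves 160 non-zero cyclic classes; (iii) GROUP-LEVEL PROVENANCE: expanding
`τ(e^{h₁}e^{B₁}e^{h₂}e^{B₂}e^{−B₃}e^{−h₃}e^{−B₄}e^{−h₄})` shows that an3's `P21`, `P22`, `P11`, `P12` ARE its Taylor components as polynomials,
that `d/dε log(e^{ελ(b₋)} e^{B_b} e^{−ελ(b₊)})|₀ = W₀λ_b + ½[λ(b₋)+λ(b₊), B_b] + (1/12)[B_b,[B_b, W₀λ_b]] + O(B³)`, and that the `ε¹`-variation of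
the traced word under `h ↦ h + ε·ad_λ h`, `e^{B_b} ↦ e^{ελ(b₋)} e^{B_b} e^{−ελ(b₊)}` vanishes cyclically in every bidegree up to `(2,2)` — its
`(h², B¹)` component IS (bgW₂).  The kernel re-verifies every ring identity and trusts nothing; the engine is a records-level second reading.
`maxHeartbeats` is raised per theorem, uniformly (the whole file elaborates in < 100 s on the farm).

## Why (row D1, both kernel binders; road BF-x)

(bgW₂) is the order-`B¹` successor of the order-`B⁰` background identity `F_{2,1}(h ; W₀λ) + Pol F_{2,0}(h, ad_λ h) = 0` (leaf-05-g2's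
`WilsonJetDivergence.jet21_grad` in lattice form; an1-g26's `bgWard21`), whose stencil transcription is the Wilson DIVERGENCE law
`WilsonDivergenceContact.divV_wilsonA_eq_conjV` consumed by the hW root at level 0.  Read on the lattice with `λ = δ_u·Y`, (bgW₂) says:
(the divergence of the SECOND-order Wilson table `W₂₂` in its first background leg at the site `u`, against a background bond `(κ′,u′)` in
the second leg) + (the commutator of the own-site generator `X_u` with the FIRST-order table at `(κ′,u′)`) + (`R₂` := the first-order table at
`(κ′,u′)` with its background letter rotated by the ENDPOINT-AVERAGE generator `½(λ(u′) + λ(u′+e_κ′))` — non-zero only when the bond touches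
`u`) `= 0`.  That is the SHAPE of the «(S₂-row law), Wilson sector» of an1-g27's `SKELETON-D1-L4.v0.md` §4 (the W-side (L4) of BOTH D1
binders hR/hW of the recursive wall literal) and of the (W2) socket `divW Wf u λ′ u′ = X u ∘ S λ′ u′ − S λ′ u′ ∘ X u (+ R₂)` of leaf-01's
`D1BFx/FineHessianWard.…_of_laws` for the Wilson-quartic table `D1BFx/WilsonQuarticStencil.wq` (road BF-x leaf T5-E₂) — AT RING LEVEL ONLY:
the coordinate / colour-stripping / lattice-sum / `ℤ^{d+1}` transcription (the pattern `WilsonStencilDivergence → WilsonDivergenceContact` one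
order up; leaf-10-g2's exact stencil toy «D1-hW-L4-W2TOY» is its cheapest falsifier) is NOT done here and R₂'s stencil form is a PREDICTION
of this file's letters, not a theorem of it.

REMARK (records, not proved here): for `λ` at `x₂`, `x₃`, `x₄` the entries hold WITHOUT the trace, as identities of the ordered product
(the background gauge at a corner other than the base point leaves the WORD invariant letter by letter: the engine's recursion form of those
twelve entries is the zero polynomial); only at the base corner `x₁` is the word conjugated and the trace needed.

## What these files do NOT do

No all-letters restatement of (bgW₂), no lattice sum, no coordinates, no stencil, no statement about `StepJetData.wilsonA`,
`WilsonBiStencil.wilsonW₂`, `WardTransversal`, (D1), `BetaPertH` or any estimate; nothing at order `B²` of the background slot; they move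
no wall statement; not summit progress, not the continuum limit, not Clay.  [folklore] throughout.
-/

namespace Summit.QuantumFields.BalabanUV.Beta.WilsonBackgroundWard22

open Literature.MathematicalPhysics.QuantumFieldTheory.Balaban1983to89.Beta.TransportVertices
open Literature.MathematicalPhysics.QuantumFieldTheory.Balaban1983to89.Beta.WilsonVertex
open Literature.MathematicalPhysics.QuantumFieldTheory.Balaban1983to89.Beta.WilsonVertex2
open Literature.MathematicalPhysics.QuantumFieldTheory.Balaban1983to89.Beta.SpinTable (br)
open Literature.MathematicalPhysics.QuantumFieldTheory.Balaban1983to89.Beta.WilsonWardJets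
  (csum csum_nil csum_cons trace_eq_zero_of_eq_csum)
open Literature.MathematicalPhysics.QuantumFieldTheory.Balaban1983to89.Beta.WilsonWardJets2
  (two_smul_twist₂_plaq four_smul_trace_P22 four_smul_trace_P21)

/-! ## The entries `bgWard22_x{k}_b{m}`, `k ∈ {1,2}` (`λ = l` at the corner `x_k`, background `b` on the bond `b_m`, fluctuation `h₁ … h₄` arbitrary) -/
section Entries

variable (𝕜 : Type*) [RCLike 𝕜] {𝔸 : Type*} [NormedRing 𝔸] [NormedAlgebra 𝕜 𝔸]
variable {V : Type*} [AddCommGroup V] [Module 𝕜 V]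
variable (τ : 𝔸 →ₗ[𝕜] V) (h₁ h₂ h₃ h₄ b l : 𝔸)

set_option maxHeartbeats 2000000 in
/-- **Entry `(x_1, b_1)`** of the order-`(W², B¹)` BACKGROUND-gauge Ward identity: `λ = l` at the base corner `x₁` (start of `b₁` and `b₄`) only, the background `B = b` on `b₁ : x₁ → x₂` only, the fluctuation `h = (h₁, h₂, h₃, h₄)` arbitrary; groups present: `F_{2,2}` (polarised in the background against `W₀λ`), `F_{2,1}` (polarised in the fluctuation against `ad_λ h`), and the ROTATED-LETTER term `2·F_{2,1}(h; [λ(b₋)+λ(b₊), B])` (the corner touches the bond).  Collected difference 136 monomials, certificate 98. [folklore] -/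
theorem bgWard22_x1_b1 (hτ : ∀ a b : 𝔸, τ (a * b) = τ (b * a)) :
    (4 : 𝕜) • τ (P22 𝕜 (plaq h₁ h₂ h₃ h₄ (b + l) 0 0 l))
      - (4 : 𝕜) • τ (P22 𝕜 (plaq h₁ h₂ h₃ h₄ b 0 0 0))
      - (4 : 𝕜) • τ (P22 𝕜 (plaq h₁ h₂ h₃ h₄ l 0 0 l))
      + ((4 : 𝕜) • τ (P21 𝕜 (plaq (h₁ + l * h₁ - h₁ * l) h₂ h₃ (h₄ + l * h₄ - h₄ * l) b 0 0 0))
          - (4 : 𝕜) • τ (P21 𝕜 (plaq h₁ h₂ h₃ h₄ b 0 0 0))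
          - (4 : 𝕜) • τ (P21 𝕜 (plaq (l * h₁ - h₁ * l) 0 0 (l * h₄ - h₄ * l) b 0 0 0)))
      + (2 : 𝕜) • τ (P21 𝕜 (plaq h₁ h₂ h₃ h₄ (l * b - b * l) 0 0 0))
      = 0 := by
  simp only [four_smul_trace_P22 𝕜 τ hτ, four_smul_trace_P21 𝕜 τ hτ, two_smul_trace_P21 𝕜 τ hτ, two_smul_twist₂_plaq,
    two_smul_qtwistAux, wpart_plaq, bpart_plaq, twist_plaq, sum_four_signed, two_smul_quad, commSum_four]
  simp only [plaq, ctwistAux_consW, ctwistAux_consB, ctwistAux_nil, twistAux_consW, twistAux_consB, twistAux_nil, wpart_consW,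
    wpart_consB, wpart_nil, List.sum_cons, List.sum_nil]
  simp only [two_smul, ← map_add, ← map_sub]
  refine trace_eq_zero_of_eq_csum 𝕜 τ hτ
    [(h₁,
      (h₃ * l * b) + (h₄ * l * b) + (l * b * h₂) - (h₂ * l * b) - (l * b * h₃) - (l * b * h₄)),
    (h₂,
      (h₁ * l * b) + 2 * (h₂ * b * l) + 3 * (h₃ * l * b) + (h₄ * l * b) + 2 * (l * h₄ * b) - 2 * (h₂ * l * b) - 2 * (h₃ * b * l) - 2 * (h₄ * b * l) - (l * b * h₁) - (l * b * h₃) - (l * b * h₄)),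
    (h₃,
      (h₂ * l * b) + 2 * (h₃ * b * l) + 2 * (h₄ * b * l) + (l * b * h₁) + (l * b * h₂) + (l * b * h₄) - (h₁ * l * b) - 2 * (h₂ * b * l) - 2 * (h₃ * l * b) - (h₄ * l * b) - 2 * (l * h₄ * b)),
    (h₄,
      (h₂ * l * b) + (l * b * h₁) + (l * b * h₂) + 2 * (l * h₃ * b) - (h₁ * l * b) - (h₃ * l * b) - (l * b * h₃) - 2 * (l * h₂ * b)),
    (b,
      2 * (h₁ * h₄ * l) + 2 * (h₁ * l * h₃) + 2 * (h₂ * h₁ * l) + 2 * (h₂ * h₃ * l) + 2 * (h₂ * h₄ * l) + 2 * (h₂ * l * h₂) + 2 * (h₃ * h₂ * l) + 2 * (h₃ * l * h₁) + 2 * (h₃ * l * h₃) + 2 * (h₃ * l * h₄) + 2 * (h₄ * h₂ * l) + 4 * (h₄ * l * h₃) + (l * h₁ * h₂) + (l * h₂ * h₁) + (l * h₂ * h₃) + (l * h₂ * h₄) + (l * h₄ * h₁) + (l * h₄ * h₂) - 2 * (h₁ * l * h₂) - 2 * (h₂ * h₂ * l) - 2 * (h₂ * l * h₁) - 2 * (h₂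 * l * h₃) - 2 * (h₂ * l * h₄) - 2 * (h₃ * h₁ * l) - 2 * (h₃ * h₃ * l) - 2 * (h₃ * h₄ * l) - 2 * (h₃ * l * h₂) - 2 * (h₄ * h₁ * l) - 2 * (h₄ * h₃ * l) - 4 * (h₄ * l * h₂) - (l * h₁ * h₃) - (l * h₁ * h₄) - (l * h₃ * h₁) - (l * h₃ * h₂) - (l * h₃ * h₄) - (l * h₄ * h₃)),
    (l,
      4 * (h₁ * b * h₂) + 2 * (h₁ * h₁ * b) + (h₁ * h₃ * b) + (h₁ * h₄ * b) + 2 * (h₂ * b * h₂) + (h₂ * h₁ * b) + 2 * (h₃ * b * h₃) + 4 * (h₃ * b * h₄) + (h₃ * h₂ * b) + (h₃ * h₄ * b) + 2 * (h₄ * b * h₃) + 4 * (h₄ * b * h₄) + 3 * (h₄ * h₂ * b) - 4 * (h₁ * b * h₃) - 4 * (h₁ * b * h₄) - (h₁ * h₂ * b) - 2 * (h₂ * b * h₃) - 4 * (h₂ * b * h₄) - (h₂ * h₃ * b) - (h₂ * h₄ * b) - 2 * (h₃ * b * h₂) - (h₃ * h₁ * b) - 2 * (h₄ * b * h₂) -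 (h₄ * h₁ * b) - 3 * (h₄ * h₃ * b) - 2 * (h₄ * h₄ * b))] ?_
  simp only [csum_cons, csum_nil, br]
  noncomm_ring

set_option maxHeartbeats 2000000 in
/-- **Entry `(x_1, b_2)`** of the order-`(W², B¹)` BACKGROUND-gauge Ward identity: `λ = l` at the base corner `x₁` (start of `b₁` and `b₄`) only, the background `B = b` on `b₂ : x₂ → x₃` only, the fluctuation `h = (h₁, h₂, h₃, h₄)` arbitrary; groups present: `F_{2,2}` (polarised in the background against `W₀λ`), `F_{2,1}` (polarised in the fluctuation against `ad_λ h`) (no rotated-letter term: the corner does not touch the bond).  Collected difference 86 monomials, certificate 58. [folklore] -/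
theorem bgWard22_x1_b2 (hτ : ∀ a b : 𝔸, τ (a * b) = τ (b * a)) :
    (4 : 𝕜) • τ (P22 𝕜 (plaq h₁ h₂ h₃ h₄ l b 0 l))
      - (4 : 𝕜) • τ (P22 𝕜 (plaq h₁ h₂ h₃ h₄ 0 b 0 0))
      - (4 : 𝕜) • τ (P22 𝕜 (plaq h₁ h₂ h₃ h₄ l 0 0 l))
      + ((4 : 𝕜) • τ (P21 𝕜 (plaq (h₁ + l * h₁ - h₁ * l) h₂ h₃ (h₄ + l * h₄ - h₄ * l) 0 b 0 0))
          - (4 : 𝕜) • τ (P21 𝕜 (plaq h₁ h₂ h₃ h₄ 0 b 0 0))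
          - (4 : 𝕜) • τ (P21 𝕜 (plaq (l * h₁ - h₁ * l) 0 0 (l * h₄ - h₄ * l) 0 b 0 0)))
      = 0 := by
  simp only [four_smul_trace_P22 𝕜 τ hτ, four_smul_trace_P21 𝕜 τ hτ, two_smul_twist₂_plaq, two_smul_qtwistAux,
    wpart_plaq, bpart_plaq, twist_plaq, sum_four_signed, two_smul_quad, commSum_four]
  simp only [plaq, ctwistAux_consW, ctwistAux_consB, ctwistAux_nil, twistAux_consW, twistAux_consB, twistAux_nil, wpart_consW,
    wpart_consB, wpart_nil, List.sum_cons, List.sum_nil]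
  simp only [← map_add, ← map_sub]
  refine trace_eq_zero_of_eq_csum 𝕜 τ hτ
    [(h₂,
      2 * (l * h₃ * b) + 2 * (l * h₄ * b) - 2 * (h₃ * b * l) - 2 * (h₄ * b * l)),
    (h₃,
      2 * (h₂ * l * b) + 2 * (h₃ * b * l) + 2 * (h₄ * b * l) - 2 * (h₃ * l * b) - 2 * (l * h₂ * b) - 2 * (l * h₄ * b)),
    (h₄,
      2 * (h₂ * l * b) + 2 * (l * h₃ * b) - 2 * (h₃ * l * b) - 2 * (l * h₂ * b)),
    (b,
      2 * (h₁ * h₄ * l) + 2 * (h₁ * l * h₃) + 2 * (h₂ * h₁ * l) + 2 * (h₂ * h₄ * l) + 2 * (h₃ * h₂ * l) + 2 * (h₃ * l * h₁) + 2 * (h₃ * l * h₃) + 2 * (h₃ * l * h₄) + 2 * (h₄ * h₂ * l) + 4 * (h₄ * l * h₃) + 2 * (l * h₁ * h₂) + 2 * (l * h₄ * h₁) + 2 * (l * h₄ * h₂) - 2 * (h₁ * l * h₂) - 2 * (h₂ * l * h₁) - 2 * (h₂ * l * h₄) - 2 * (h₃ * h₁ * l) - 2 * (h₃ * h₃ *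 l) - 2 * (h₃ * h₄ * l) - 2 * (h₃ * l * h₂) - 2 * (h₄ * h₁ * l) - 2 * (h₄ * h₃ * l) - 4 * (h₄ * l * h₂) - 2 * (l * h₁ * h₃) - 2 * (l * h₁ * h₄) - 2 * (l * h₄ * h₃)),
    (l,
      2 * (h₁ * h₁ * b) + 4 * (h₁ * h₂ * b) + 2 * (h₂ * h₂ * b) + 2 * (h₃ * b * h₂) + 2 * (h₃ * b * h₃) + 4 * (h₃ * b * h₄) + 2 * (h₃ * h₄ * b) + 2 * (h₄ * b * h₂) + 2 * (h₄ * b * h₃) + 4 * (h₄ * b * h₄) - 4 * (h₁ * b * h₃) - 4 * (h₁ * b * h₄) - 4 * (h₂ * b * h₃) - 4 * (h₂ * b * h₄) - 2 * (h₂ * h₃ * b) - 2 * (h₂ * h₄ * b) - 4 * (h₄ * h₃ * b) - 2 * (h₄ * h₄ * b))] ?_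
  simp only [csum_cons, csum_nil, br]
  noncomm_ring

set_option maxHeartbeats 2000000 in
/-- **Entry `(x_1, b_3)`** of the order-`(W², B¹)` BACKGROUND-gauge Ward identity: `λ = l` at the base corner `x₁` (start of `b₁` and `b₄`) only, the background `B = b` on `b₃ : x₄ → x₃` only, the fluctuation `h = (h₁, h₂, h₃, h₄)` arbitrary; groups present: `F_{2,2}` (polarised in the background against `W₀λ`), `F_{2,1}` (polarised in the fluctuation against `ad_λ h`) (no rotated-letter term: the corner does not touch the bond).  Collected difference 86 monomials, certificate 58. [folklore] -/
theorem bgWard22_x1_b3 (hτ : ∀ a b : 𝔸, τ (a * b) = τ (b * a)) :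
    (4 : 𝕜) • τ (P22 𝕜 (plaq h₁ h₂ h₃ h₄ l 0 b l))
      - (4 : 𝕜) • τ (P22 𝕜 (plaq h₁ h₂ h₃ h₄ 0 0 b 0))
      - (4 : 𝕜) • τ (P22 𝕜 (plaq h₁ h₂ h₃ h₄ l 0 0 l))
      + ((4 : 𝕜) • τ (P21 𝕜 (plaq (h₁ + l * h₁ - h₁ * l) h₂ h₃ (h₄ + l * h₄ - h₄ * l) 0 0 b 0))
          - (4 : 𝕜) • τ (P21 𝕜 (plaq h₁ h₂ h₃ h₄ 0 0 b 0))
          - (4 : 𝕜) • τ (P21 𝕜 (plaq (l * h₁ - h₁ * l) 0 0 (l * h₄ - h₄ * l) 0 0 b 0)))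
      = 0 := by
  simp only [four_smul_trace_P22 𝕜 τ hτ, four_smul_trace_P21 𝕜 τ hτ, two_smul_twist₂_plaq, two_smul_qtwistAux,
    wpart_plaq, bpart_plaq, twist_plaq, sum_four_signed, two_smul_quad, commSum_four]
  simp only [plaq, ctwistAux_consW, ctwistAux_consB, ctwistAux_nil, twistAux_consW, twistAux_consB, twistAux_nil, wpart_consW,
    wpart_consB, wpart_nil, List.sum_cons, List.sum_nil]
  simp only [← map_add, ← map_sub]
  refine trace_eq_zero_of_eq_csum 𝕜 τ hτ
    [(h₂,
      2 * (h₃ * b * l) + 2 * (h₄ * b * l) - 2 * (l * h₃ * b) - 2 * (l * h₄ * b)),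
    (h₃,
      2 * (h₃ * l * b) + 2 * (l * h₂ * b) + 2 * (l * h₄ * b) - 2 * (h₂ * l * b) - 2 * (h₃ * b * l) - 2 * (h₄ * b * l)),
    (h₄,
      2 * (h₃ * l * b) + 2 * (l * h₂ * b) - 2 * (h₂ * l * b) - 2 * (l * h₃ * b)),
    (b,
      2 * (h₁ * l * h₂) + 2 * (h₂ * l * h₁) + 2 * (h₂ * l * h₄) + 2 * (h₃ * h₁ * l) + 2 * (h₃ * h₃ * l) + 2 * (h₃ * h₄ * l) + 2 * (h₃ * l * h₂) + 2 * (h₄ * h₁ * l) + 2 * (h₄ * h₃ * l) + 4 * (h₄ * l * h₂) + 2 * (l * h₁ * h₃) + 2 * (l * h₁ * h₄) + 2 * (l * h₄ * h₃) - 2 * (h₁ * h₄ * l) - 2 * (h₁ * l * h₃) - 2 * (h₂ * h₁ * l) - 2 * (h₂ * h₄ * l) - 2 * (h₃ * h₂ * l) - 2 * (h₃ * l * h₁) - 2 * (h₃ * l * h₃) - 2 * (h₃ * l * h₄) - 2 * (h₄ * h₂ * l) - 4 * (h₄ * l * h₃) - 2 * (l * h₁ * h₂) - 2 * (l * h₄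 * h₁) - 2 * (l * h₄ * h₂)),
    (l,
      4 * (h₁ * b * h₃) + 4 * (h₁ * b * h₄) + 4 * (h₂ * b * h₃) + 4 * (h₂ * b * h₄) + 2 * (h₂ * h₃ * b) + 2 * (h₂ * h₄ * b) + 4 * (h₄ * h₃ * b) + 2 * (h₄ * h₄ * b) - 2 * (h₁ * h₁ * b) - 4 * (h₁ * h₂ * b) - 2 * (h₂ * h₂ * b) - 2 * (h₃ * b * h₂) - 2 * (h₃ * b * h₃) - 4 * (h₃ * b * h₄) - 2 * (h₃ * h₄ * b) - 2 * (h₄ * b * h₂) - 2 * (h₄ * b * h₃) - 4 * (h₄ * b * h₄))] ?_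
  simp only [csum_cons, csum_nil, br]
  noncomm_ring

set_option maxHeartbeats 2000000 in
/-- **Entry `(x_1, b_4)`** of the order-`(W², B¹)` BACKGROUND-gauge Ward identity: `λ = l` at the base corner `x₁` (start of `b₁` and `b₄`) only, the background `B = b` on `b₄ : x₁ → x₄` only, the fluctuation `h = (h₁, h₂, h₃, h₄)` arbitrary; groups present: `F_{2,2}` (polarised in the background against `W₀λ`), `F_{2,1}` (polarised in the fluctuation against `ad_λ h`), and the ROTATED-LETTER term `2·F_{2,1}(h; [λ(b₋)+λ(b₊), B])` (the corner touches the bond).  Collected difference 103 monomials, certificate 80. [folklore] -/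
theorem bgWard22_x1_b4 (hτ : ∀ a b : 𝔸, τ (a * b) = τ (b * a)) :
    (4 : 𝕜) • τ (P22 𝕜 (plaq h₁ h₂ h₃ h₄ l 0 0 (b + l)))
      - (4 : 𝕜) • τ (P22 𝕜 (plaq h₁ h₂ h₃ h₄ 0 0 0 b))
      - (4 : 𝕜) • τ (P22 𝕜 (plaq h₁ h₂ h₃ h₄ l 0 0 l))
      + ((4 : 𝕜) • τ (P21 𝕜 (plaq (h₁ + l * h₁ - h₁ * l) h₂ h₃ (h₄ + l * h₄ - h₄ * l) 0 0 0 b))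
          - (4 : 𝕜) • τ (P21 𝕜 (plaq h₁ h₂ h₃ h₄ 0 0 0 b))
          - (4 : 𝕜) • τ (P21 𝕜 (plaq (l * h₁ - h₁ * l) 0 0 (l * h₄ - h₄ * l) 0 0 0 b)))
      + (2 : 𝕜) • τ (P21 𝕜 (plaq h₁ h₂ h₃ h₄ 0 0 0 (l * b - b * l)))
      = 0 := by
  simp only [four_smul_trace_P22 𝕜 τ hτ, four_smul_trace_P21 𝕜 τ hτ, two_smul_trace_P21 𝕜 τ hτ, two_smul_twist₂_plaq,
    two_smul_qtwistAux, wpart_plaq, bpart_plaq, twist_plaq, sum_four_signed, two_smul_quad, commSum_four]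
  simp only [plaq, ctwistAux_consW, ctwistAux_consB, ctwistAux_nil, twistAux_consW, twistAux_consB, twistAux_nil, wpart_consW,
    wpart_consB, wpart_nil, List.sum_cons, List.sum_nil]
  simp only [two_smul, ← map_add, ← map_sub]
  refine trace_eq_zero_of_eq_csum 𝕜 τ hτ
    [(h₁,
      (h₂ * l * b) + (l * b * h₃) + (l * b * h₄) - (h₃ * l * b) - (h₄ * l * b) - (l * b * h₂)),
    (h₂,
      2 * (h₄ * b * l) + (l * b * h₁) + (l * b * h₃) + (l * b * h₄) - (h₁ * l * b) - (h₃ * l * b) - (h₄ * l * b) - 2 * (l * h₄ * b)),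
    (h₃,
      (h₁ * l * b) + (h₂ * l * b) + (h₄ * l * b) + 2 * (l * h₄ * b) - 2 * (h₄ * b * l) - (l * b * h₁) - (l * b * h₂) - (l * b * h₄)),
    (h₄,
      (h₁ * l * b) + (h₃ * l * b) + (l * b * h₃) + 2 * (l * h₂ * b) - (h₂ * l * b) - (l * b * h₁) - (l * b * h₂) - 2 * (l * h₃ * b)),
    (b,
      2 * (h₁ * l * h₂) + 2 * (h₂ * l * h₁) + 2 * (h₂ * l * h₄) + 2 * (h₃ * h₁ * l) + 2 * (h₃ * h₄ * l) + 2 * (h₄ * h₁ * l) + 2 * (h₄ * h₃ * l) + 4 * (h₄ * l * h₂) + (l * h₁ * h₃) + (l * h₁ * h₄) + (l * h₃ * h₁) + (l * h₃ * h₂) + (l * h₃ * h₄) + (l * h₄ * h₃) - 2 * (h₁ * h₄ * l) - 2 * (h₁ * l * h₃) - 2 * (h₂ * h₁ * l) - 2 * (h₂ * h₄ * l) - 2 * (h₃ * l * h₁) - 2 * (h₃ * l * h₄) - 2 * (h₄ * h₂ * l) - 4 * (h₄ * l * h₃) - (l * h₁ * h₂) - (l * h₂ * h₁) - (l * h₂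 * h₃) - (l * h₂ * h₄) - (l * h₄ * h₁) - (l * h₄ * h₂)),
    (l,
      4 * (h₁ * b * h₄) + 3 * (h₁ * h₃ * b) + 4 * (h₂ * b * h₄) + 3 * (h₂ * h₃ * b) + (h₂ * h₄ * b) + (h₃ * h₁ * b) + (h₃ * h₂ * b) + 2 * (h₄ * b * h₃) + (h₄ * h₁ * b) + (h₄ * h₂ * b) + 2 * (h₄ * h₄ * b) - 2 * (h₁ * h₁ * b) - 3 * (h₁ * h₂ * b) - (h₁ * h₄ * b) - (h₂ * h₁ * b) - 2 * (h₂ * h₂ * b) - 4 * (h₃ * b * h₄) - 2 * (h₃ * h₃ * b) - (h₃ * h₄ * b) - 2 * (h₄ * b * h₂) - 4 * (h₄ * b * h₄) - (h₄ * h₃ * b))] ?_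
  simp only [csum_cons, csum_nil, br]
  noncomm_ring

set_option maxHeartbeats 2000000 in
/-- **Entry `(x_2, b_1)`** of the order-`(W², B¹)` BACKGROUND-gauge Ward identity: `λ = l` at `x₂` (end of `b₁`, start of `b₂`) only, the background `B = b` on `b₁ : x₁ → x₂` only, the fluctuation `h = (h₁, h₂, h₃, h₄)` arbitrary; groups present: `F_{2,2}` (polarised in the background against `W₀λ`), `F_{2,1}` (polarised in the fluctuation against `ad_λ h`), and the ROTATED-LETTER term `2·F_{2,1}(h; [λ(b₋)+λ(b₊), B])` (the corner touches the bond).  Collected difference 82 monomials, certificate 71. [folklore] -/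
theorem bgWard22_x2_b1 (hτ : ∀ a b : 𝔸, τ (a * b) = τ (b * a)) :
    (4 : 𝕜) • τ (P22 𝕜 (plaq h₁ h₂ h₃ h₄ (b - l) l 0 0))
      - (4 : 𝕜) • τ (P22 𝕜 (plaq h₁ h₂ h₃ h₄ b 0 0 0))
      - (4 : 𝕜) • τ (P22 𝕜 (plaq h₁ h₂ h₃ h₄ (-l) l 0 0))
      + ((4 : 𝕜) • τ (P21 𝕜 (plaq h₁ (h₂ + l * h₂ - h₂ * l) h₃ h₄ b 0 0 0))
          - (4 : 𝕜) • τ (P21 𝕜 (plaq h₁ h₂ h₃ h₄ b 0 0 0))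
          - (4 : 𝕜) • τ (P21 𝕜 (plaq 0 (l * h₂ - h₂ * l) 0 0 b 0 0 0)))
      + (2 : 𝕜) • τ (P21 𝕜 (plaq h₁ h₂ h₃ h₄ (l * b - b * l) 0 0 0))
      = 0 := by
  simp only [four_smul_trace_P22 𝕜 τ hτ, four_smul_trace_P21 𝕜 τ hτ, two_smul_trace_P21 𝕜 τ hτ, two_smul_twist₂_plaq,
    two_smul_qtwistAux, wpart_plaq, bpart_plaq, twist_plaq, sum_four_signed, two_smul_quad, commSum_four]
  simp only [plaq, ctwistAux_consW, ctwistAux_consB, ctwistAux_nil, twistAux_consW, twistAux_consB, twistAux_nil, wpart_consW,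
    wpart_consB, wpart_nil, List.sum_cons, List.sum_nil]
  simp only [two_smul, ← map_add, ← map_sub]
  refine trace_eq_zero_of_eq_csum 𝕜 τ hτ
    [(h₁,
      (h₃ * l * b) + (h₄ * l * b) + (l * b * h₂) - (h₂ * l * b) - (l * b * h₃) - (l * b * h₄)),
    (h₂,
      (h₁ * l * b) + 2 * (h₂ * l * b) + 2 * (h₃ * b * l) + (h₃ * l * b) + 2 * (h₄ * b * l) + (h₄ * l * b) - 2 * (h₂ * b * l) - (l * b * h₁) - (l * b * h₃) - (l * b * h₄) - 2 * (l * h₃ * b) - 2 * (l * h₄ * b)),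
    (h₃,
      (l * b * h₁) + (l * b * h₂) + (l * b * h₄) + 2 * (l * h₂ * b) - (h₁ * l * b) - 3 * (h₂ * l * b) - (h₄ * l * b)),
    (h₄,
      (h₃ * l * b) + (l * b * h₁) + (l * b * h₂) + 2 * (l * h₂ * b) - (h₁ * l * b) - 3 * (h₂ * l * b) - (l * b * h₃)),
    (b,
      2 * (h₁ * l * h₂) + 2 * (h₂ * h₂ * l) + 2 * (h₂ * l * h₁) + 2 * (h₂ * l * h₃) + 2 * (h₂ * l * h₄) + 4 * (h₃ * l * h₂) + 4 * (h₄ * l * h₂) + (l * h₁ * h₃) + (l * h₁ * h₄) + (l * h₄ * h₃) - 2 * (h₁ * h₂ * l) - 2 * (h₂ * l * h₂) - 4 * (h₃ * h₂ * l) - 4 * (h₄ * h₂ * l) - (l * h₁ * h₂) - (l * h₂ * h₁) - (l * h₂ * h₃) - (l * h₂ * h₄) - (l * h₃ * h₁) - (l * h₃ * h₂) - (l * h₃ * h₄) - (l * h₄ * h₁) - (l * h₄ * h₂)),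
    (l,
      (h₁ * h₃ * b) + (h₁ * h₄ * b) + 2 * (h₂ * b * h₂) + (h₂ * h₁ * b) + 3 * (h₂ * h₃ * b) + 3 * (h₂ * h₄ * b) + (h₄ * h₃ * b) - (h₁ * h₂ * b) - 2 * (h₂ * h₂ * b) - 2 * (h₃ * b * h₂) - (h₃ * h₁ * b) - (h₃ * h₂ * b) - (h₃ * h₄ * b) - 2 * (h₄ * b * h₂) - (h₄ * h₁ * b) - (h₄ * h₂ * b))] ?_
  simp only [csum_cons, csum_nil, br]
  noncomm_ring

set_option maxHeartbeats 2000000 in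
/-- **Entry `(x_2, b_2)`** of the order-`(W², B¹)` BACKGROUND-gauge Ward identity: `λ = l` at `x₂` (end of `b₁`, start of `b₂`) only, the background `B = b` on `b₂ : x₂ → x₃` only, the fluctuation `h = (h₁, h₂, h₃, h₄)` arbitrary; groups present: `F_{2,2}` (polarised in the background against `W₀λ`), `F_{2,1}` (polarised in the fluctuation against `ad_λ h`), and the ROTATED-LETTER term `2·F_{2,1}(h; [λ(b₋)+λ(b₊), B])` (the corner touches the bond).  Collected difference 74 monomials, certificate 65. [folklore] -/
theorem bgWard22_x2_b2 (hτ : ∀ a b : 𝔸, τ (a * b) = τ (b * a)) :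
    (4 : 𝕜) • τ (P22 𝕜 (plaq h₁ h₂ h₃ h₄ (-l) (b + l) 0 0))
      - (4 : 𝕜) • τ (P22 𝕜 (plaq h₁ h₂ h₃ h₄ 0 b 0 0))
      - (4 : 𝕜) • τ (P22 𝕜 (plaq h₁ h₂ h₃ h₄ (-l) l 0 0))
      + ((4 : 𝕜) • τ (P21 𝕜 (plaq h₁ (h₂ + l * h₂ - h₂ * l) h₃ h₄ 0 b 0 0))
          - (4 : 𝕜) • τ (P21 𝕜 (plaq h₁ h₂ h₃ h₄ 0 b 0 0))
          - (4 : 𝕜) • τ (P21 𝕜 (plaq 0 (l * h₂ - h₂ * l) 0 0 0 b 0 0)))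
      + (2 : 𝕜) • τ (P21 𝕜 (plaq h₁ h₂ h₃ h₄ 0 (l * b - b * l) 0 0))
      = 0 := by
  simp only [four_smul_trace_P22 𝕜 τ hτ, four_smul_trace_P21 𝕜 τ hτ, two_smul_trace_P21 𝕜 τ hτ, two_smul_twist₂_plaq,
    two_smul_qtwistAux, wpart_plaq, bpart_plaq, twist_plaq, sum_four_signed, two_smul_quad, commSum_four]
  simp only [plaq, ctwistAux_consW, ctwistAux_consB, ctwistAux_nil, twistAux_consW, twistAux_consB, twistAux_nil, wpart_consW,
    wpart_consB, wpart_nil, List.sum_cons, List.sum_nil]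
  simp only [two_smul, ← map_add, ← map_sub]
  refine trace_eq_zero_of_eq_csum 𝕜 τ hτ
    [(h₁,
      (h₃ * l * b) + (h₄ * l * b) + (l * b * h₂) - (h₂ * l * b) - (l * b * h₃) - (l * b * h₄)),
    (h₂,
      (h₁ * l * b) + 2 * (h₃ * b * l) + (h₃ * l * b) + 2 * (h₄ * b * l) + (h₄ * l * b) - (l * b * h₁) - (l * b * h₃) - (l * b * h₄) - 2 * (l * h₃ * b) - 2 * (l * h₄ * b)),
    (h₃,
      (l * b * h₁) + (l * b * h₂) + (l * b * h₄) + 2 * (l * h₂ * b) - (h₁ * l * b) - 3 * (h₂ * l * b) - (h₄ * l * b)),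
    (h₄,
      (h₃ * l * b) + (l * b * h₁) + (l * b * h₂) + 2 * (l * h₂ * b) - (h₁ * l * b) - 3 * (h₂ * l * b) - (l * b * h₃)),
    (b,
      2 * (h₁ * l * h₂) + 2 * (h₂ * l * h₁) + 2 * (h₂ * l * h₃) + 2 * (h₂ * l * h₄) + 4 * (h₃ * l * h₂) + 4 * (h₄ * l * h₂) + (l * h₁ * h₃) + (l * h₁ * h₄) + (l * h₄ * h₃) - 2 * (h₁ * h₂ * l) - 4 * (h₃ * h₂ * l) - 4 * (h₄ * h₂ * l) - (l * h₁ * h₂) - (l * h₂ * h₁) - (l * h₂ * h₃) - (l * h₂ * h₄) - (l * h₃ * h₁) - (l * h₃ * h₂) - (l * h₃ * h₄) - (l * h₄ * h₁) - (l * h₄ * h₂)),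
    (l,
      (h₁ * h₃ * b) + (h₁ * h₄ * b) + (h₂ * h₁ * b) + 3 * (h₂ * h₃ * b) + 3 * (h₂ * h₄ * b) + (h₄ * h₃ * b) - (h₁ * h₂ * b) - 2 * (h₃ * b * h₂) - (h₃ * h₁ * b) - (h₃ * h₂ * b) - (h₃ * h₄ * b) - 2 * (h₄ * b * h₂) - (h₄ * h₁ * b) - (h₄ * h₂ * b))] ?_
  simp only [csum_cons, csum_nil, br]
  noncomm_ring

set_option maxHeartbeats 2000000 in
/-- **Entry `(x_2, b_3)`** of the order-`(W², B¹)` BACKGROUND-gauge Ward identity: `λ = l` at `x₂` (end of `b₁`, start of `b₂`) only, the background `B = b` on `b₃ : x₄ → x₃` only, the fluctuation `h = (h₁, h₂, h₃, h₄)` arbitrary; groups present: `F_{2,2}` (polarised in the background against `W₀λ`), `F_{2,1}` (polarised in the fluctuation against `ad_λ h`) (no rotated-letter term: the corner does not touch the bond).  Collected difference 32 monomials, certificate 24. [folklore] -/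
theorem bgWard22_x2_b3 (hτ : ∀ a b : 𝔸, τ (a * b) = τ (b * a)) :
    (4 : 𝕜) • τ (P22 𝕜 (plaq h₁ h₂ h₃ h₄ (-l) l b 0))
      - (4 : 𝕜) • τ (P22 𝕜 (plaq h₁ h₂ h₃ h₄ 0 0 b 0))
      - (4 : 𝕜) • τ (P22 𝕜 (plaq h₁ h₂ h₃ h₄ (-l) l 0 0))
      + ((4 : 𝕜) • τ (P21 𝕜 (plaq h₁ (h₂ + l * h₂ - h₂ * l) h₃ h₄ 0 0 b 0))
          - (4 : 𝕜) • τ (P21 𝕜 (plaq h₁ h₂ h₃ h₄ 0 0 b 0))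
          - (4 : 𝕜) • τ (P21 𝕜 (plaq 0 (l * h₂ - h₂ * l) 0 0 0 0 b 0)))
      = 0 := by
  simp only [four_smul_trace_P22 𝕜 τ hτ, four_smul_trace_P21 𝕜 τ hτ, two_smul_twist₂_plaq, two_smul_qtwistAux,
    wpart_plaq, bpart_plaq, twist_plaq, sum_four_signed, two_smul_quad, commSum_four]
  simp only [plaq, ctwistAux_consW, ctwistAux_consB, ctwistAux_nil, twistAux_consW, twistAux_consB, twistAux_nil, wpart_consW,
    wpart_consB, wpart_nil, List.sum_cons, List.sum_nil]
  simp only [← map_add, ← map_sub]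
  refine trace_eq_zero_of_eq_csum 𝕜 τ hτ
    [(h₂,
      2 * (l * h₃ * b) + 2 * (l * h₄ * b) - 2 * (h₃ * b * l) - 2 * (h₄ * b * l)),
    (h₃,
      2 * (h₂ * l * b) - 2 * (l * h₂ * b)),
    (h₄,
      2 * (h₂ * l * b) - 2 * (l * h₂ * b)),
    (b,
      2 * (h₁ * h₂ * l) + 4 * (h₃ * h₂ * l) + 4 * (h₄ * h₂ * l) + 2 * (l * h₂ * h₁) + 2 * (l * h₂ * h₃) + 2 * (l * h₂ * h₄) - 2 * (h₁ * l * h₂) - 2 * (h₂ * l * h₁) - 2 * (h₂ * l * h₃) - 2 * (h₂ * l * h₄) - 4 * (h₃ * l * h₂) - 4 * (h₄ * l * h₂)),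
    (l,
      2 * (h₃ * b * h₂) + 2 * (h₄ * b * h₂) - 2 * (h₂ * h₃ * b) - 2 * (h₂ * h₄ * b))] ?_
  simp only [csum_cons, csum_nil, br]
  noncomm_ring

set_option maxHeartbeats 2000000 in
/-- **Entry `(x_2, b_4)`** of the order-`(W², B¹)` BACKGROUND-gauge Ward identity: `λ = l` at `x₂` (end of `b₁`, start of `b₂`) only, the background `B = b` on `b₄ : x₁ → x₄` only, the fluctuation `h = (h₁, h₂, h₃, h₄)` arbitrary; groups present: `F_{2,2}` (polarised in the background against `W₀λ`), `F_{2,1}` (polarised in the fluctuation against `ad_λ h`) (no rotated-letter term: the corner does not touch the bond).  Collected difference 28 monomials, certificate 18. [folklore] -/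
theorem bgWard22_x2_b4 (hτ : ∀ a b : 𝔸, τ (a * b) = τ (b * a)) :
    (4 : 𝕜) • τ (P22 𝕜 (plaq h₁ h₂ h₃ h₄ (-l) l 0 b))
      - (4 : 𝕜) • τ (P22 𝕜 (plaq h₁ h₂ h₃ h₄ 0 0 0 b))
      - (4 : 𝕜) • τ (P22 𝕜 (plaq h₁ h₂ h₃ h₄ (-l) l 0 0))
      + ((4 : 𝕜) • τ (P21 𝕜 (plaq h₁ (h₂ + l * h₂ - h₂ * l) h₃ h₄ 0 0 0 b))
          - (4 : 𝕜) • τ (P21 𝕜 (plaq h₁ h₂ h₃ h₄ 0 0 0 b))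
          - (4 : 𝕜) • τ (P21 𝕜 (plaq 0 (l * h₂ - h₂ * l) 0 0 0 0 0 b)))
      = 0 := by
  simp only [four_smul_trace_P22 𝕜 τ hτ, four_smul_trace_P21 𝕜 τ hτ, two_smul_twist₂_plaq, two_smul_qtwistAux,
    wpart_plaq, bpart_plaq, twist_plaq, sum_four_signed, two_smul_quad, commSum_four]
  simp only [plaq, ctwistAux_consW, ctwistAux_consB, ctwistAux_nil, twistAux_consW, twistAux_consB, twistAux_nil, wpart_consW,
    wpart_consB, wpart_nil, List.sum_cons, List.sum_nil]
  simp only [← map_add, ← map_sub]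
  refine trace_eq_zero_of_eq_csum 𝕜 τ hτ
    [(h₂,
      2 * (l * h₄ * b) - 2 * (h₄ * b * l)),
    (h₄,
      2 * (h₂ * l * b) - 2 * (l * h₂ * b)),
    (b,
      2 * (h₁ * h₂ * l) + 2 * (h₃ * h₂ * l) + 4 * (h₄ * h₂ * l) + 2 * (l * h₂ * h₁) + 2 * (l * h₂ * h₃) + 2 * (l * h₂ * h₄) - 2 * (h₁ * l * h₂) - 2 * (h₂ * l * h₁) - 2 * (h₂ * l * h₃) - 2 * (h₂ * l * h₄) - 2 * (h₃ * l * h₂) - 4 * (h₄ * l * h₂)),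
    (l,
      2 * (h₄ * b * h₂) - 2 * (h₂ * h₄ * b))] ?_
  simp only [csum_cons, csum_nil, br]
  noncomm_ring

end Entries

end Summit.QuantumFields.BalabanUV.Beta.WilsonBackgroundWard22
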